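import Literature.NumberTheory.Automorphic.PairLFunctionMeromorphicContinuationNeConjLocalData
import Literature.NumberTheory.Automorphic.PairLFunctionNeConjGlobalRankinSelbergThinTranslate
import Literature.NumberTheory.Automorphic.PairLFunctionNeConjGlobalRankinSelbergTranslate
import Literature.NumberTheory.Automorphic.RankinSelbergTorusHolomorphy
import HarnessLib

/-!
# Corollaire (i)(b) of Mœglin–Waldspurger for ONE pair, from THIN translated local Rankin–Selberg data

Topic `NumberTheory/Automorphic`; namespace `Literature.NumberTheory.Automorphic`. Proof file (theorems
only). `exists_entire_eq_partialPairL_of_localData_translate`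
(`PairLFunctionMeromorphicContinuationNeConjLocalDataTranslate`) derives the conclusion of the named fact
`MoeglinWaldspurger1989_partialPairL_entire_of_ne_conj` for ONE pair `π ≠ σ̄` from finitely many data of
the Rankin–Selberg method whose `S'_i`-parts are the τ-translated unit-box integrals of the global
Whittaker coefficients against the STANDARD test function `Φ_{i,∞} ⊗ 𝟙_{𝒪̂ⁿ}`. Here the test functions
are THIN at finitely many places `T_i ⊆ S'_i` (`thinTestFun n K Φ_{i,∞} T_i m_i`, i.e.
`Φ_{i,v} = 𝟙_{e_n + 𝔭_v^{m_i} 𝒪_vⁿ}` for `v ∈ T_i`): `exists_entire_eq_partialPairL_of_localData_thin_translate`.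
The proof is that of the source theorem verbatim with the two global theorems replaced by their thin
forms (`PairLFunctionNeConjGlobalRankinSelbergThinTranslate`); the residues at `1` and `0` vanish as
before. With a test function supported near `e_n` at the bad places the bad-place parts of the data can
be made constant (Jacquet–Piatetski-Shapiro–Shalika (1983), (2.7), p. 393; Cogdell (2004), §4.1–§4.2:
"for each `s₀` there is a choice of `W_v, W'_v, Φ_v` with `e_v(s₀) ≠ 0`").

## References

* C. Mœglin, J.-L. Waldspurger, *Le spectre résiduel de GL(n)*, Ann. Sci. ÉNS 22 (1989), Appendice,
  Corollaire (i)(b), p. 667 [MoeglinWaldspurger1989].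
* J. W. Cogdell, *Analytic theory of L-functions for GL_n* (2004), §3.1, §4.1–§4.2
  [CogdellAnalyticTheory2004].
* H. Jacquet, I. I. Piatetski-Shapiro, J. A. Shalika, *Rankin–Selberg convolutions*, Amer. J. Math.
  105 (1983), §2, (2.7) [JacquetPiatetskiShapiroShalika1983].
-/

noncomputable section

open MeasureTheory Measure NumberField IsDedekindDomain Matrix Set Filter Topology
open scoped ENNReal NNReal ComplexConjugate

namespace Literature.NumberTheory.Automorphic

open Literature.NumberTheory.GaloisRepresentations (ideleGroup HeckeCharacter)

-- the automorphic quotient carries the tree's Borel σ-algebra, not Mathlib's quotient σ-algebra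
-- (verbatim from `RankinSelbergUnfoldingIdentity`)
attribute [-instance] Quotient.instMeasurableSpace QuotientGroup.measurableSpace

section LocalDataThinTranslate

open ValuativeRel

variable {n : ℕ} {K : Type} [Field K] [NumberField K]
variable {μ' : Measure (AdelicGroupData.gl n K).automorphicQuotient} [(AdelicGroupData.gl n K).IsAutomorphicMeasure μ']
variable [MeasurableSpace (AdeleRing (𝓞 K) K)] [BorelSpace (AdeleRing (𝓞 K) K)]

-- the house local instances, exactly as in `RankinSelbergUnfoldingIdentity`
attribute [local instance] adelicBorel borelSpace_adelic locallyCompactSpace_adelic secondCountableTopology_gl_adelic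
  glAdeleBorel borelSpace_glAdele borelSpace_ideleGroup secondCountableTopology_ideleGroup

/-- **Corollaire (i)(b) for one pair from THIN translated local Rankin–Selberg data.** As
`exists_entire_eq_partialPairL_of_localData_translate`, but the `i`-th test function is
`thinTestFun n K Φ_{i,∞} T_i m_i` for finite sets `T_i ⊆ S'_i` of finite places and depths `m_i`, and the
identity `B(s) ∑_i c_i (∏_{v ∈ S'_i ∖ S₀} P_v(q_v^{-s})) Ψ^τ_{S'_i}(s) = 1` on the strip is required for
the translated THIN `S'`-parts. Then `partialPairL S₀ α β` extends to an entire function (by the thin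
global theorems `∑ c_i F_i = s (s - 1) C w_s(τ) L^{S₀} ∑ c_i ∏ P_v Ψ^τ_i`, resp. without `s (s - 1)` in the
twisted case, and the vanishing of the residues at `1`, `0`; Cogdell (2004), §4.1–§4.2).
[cite: MoeglinWaldspurger1989, Appendice, Corollaire (i)(b), p. 667] [cite: CogdellAnalyticTheory2004, §3.1, §4.1–§4.2]
[cite: JacquetPiatetskiShapiroShalika1983, §2 (2.7)] -/
theorem exists_entire_eq_partialPairL_of_localData_thin_translate
    (νI : Measure (ideleGroup K)) [νI.IsHaarMeasure]
    (νA : Measure (Fin n → ideleGroup K)) [IsHaarMeasure νA]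
    (νK : Measure ↥(maximalCompactAdelic n K)) [IsHaarMeasure νK]
    (ν₀ : Measure ↥(adelicUnipotent n K)) [IsHaarMeasure ν₀]
    (hn : 0 < n) (h₁ : multiplicity_one_gl n K μ')
    (P P' : CuspidalAutomorphicRepGL n K μ') (hne : P ≠ P'.conj)
    {S₀ : Set (HeightOneSpectrum (𝓞 K))} {α β : SatakeFamily K}
    (hα : IsSatakeFamilyOf P S₀ α) (hβ : IsSatakeFamilyOf P' S₀ β)
    {m : ℕ} (c : Fin m → ℂ) (f : Fin m → P.1.toSubmodule) (f' : Fin m → P'.conj.1.toSubmodule)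
    {𝔫₀ : Fin m → Ideal (𝓞 K)} (h𝔫₀ : ∀ i, 𝔫₀ i ≠ 0)
    {η : Fin m → (AdelicGroupData.gl n K).Adelic → ℝ} (hη : ∀ i, IsTestFunctionGL n K (η i))
    (hηK : ∀ i, ∀ k : (AdelicGroupData.gl n K).Adelic, k ∈ principalCongruenceLevel n K (𝔫₀ i) →
      ∀ g : (AdelicGroupData.gl n K).Adelic, η i (k * g) = η i g)
    {S' : Fin m → Set (HeightOneSpectrum (𝓞 K))} (hS'f : ∀ i, (S' i \ S₀).Finite) (hS₀S' : ∀ i, S₀ ⊆ S' i)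
    (hS' : ∀ i, ∀ v ∉ S' i, ¬ v.asIdeal ∣ 𝔫₀ i)
    {Tth : Fin m → Finset (HeightOneSpectrum (𝓞 K))} (mth : Fin m → ℕ)
    (hTS' : ∀ i, (↑(Tth i) : Set (HeightOneSpectrum (𝓞 K))) ⊆ S' i)
    (τ : Fin n → ideleGroup K) (hτ : lastEntry τ = 1)
    (hτψ : ∀ i, ∀ v ∉ S' i, ∃ (d : Fin n → (v.adicCompletion K)ˣ) (a : (v.adicCompletion K)ˣ),
      localComponent v (glDiagonal n (AdeleRing (𝓞 K) K) τ) = diagonalGL (Fin n) (v.adicCompletion K) d ∧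
      (∀ i j : Fin n, (i : ℕ) + 1 = j →
        (d i : v.adicCompletion K) * ((d j)⁻¹ : (v.adicCompletion K)ˣ) = a) ∧
      (∀ c ∈ 𝒪[v.adicCompletion K], (adeleAddChar K).adicComponent v (a * c) = 1) ∧
      ∀ ϖ : v.adicCompletion K, Valued.v ϖ = WithZero.exp (-1 : ℤ) →
        ∃ c ∈ 𝒪[v.adicCompletion K], (adeleAddChar K).adicComponent v (a * (ϖ⁻¹ * c)) ≠ 1)
    {x y : Fin m → HeightOneSpectrum (𝓞 K) → Fin n → ℂ}
    (hx : ∀ i, ∀ v ∉ S' i, (Finset.univ : Finset (Fin n)).val.map (x i v) = α v)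
    (hy : ∀ i, ∀ v ∉ S' i, (Finset.univ : Finset (Fin n)).val.map (y i v) = (β v).map conj)
    {Φinf : Fin m → (Fin n → InfiniteAdeleRing K) → ℝ} (hΦc : ∀ i, Continuous (Φinf i))
    (hΦ0 : ∀ i, ∀ z, 0 ≤ Φinf i z)
    (hΦS : ∀ i, (fun v => ((thinTestFun n K (Φinf i) (Tth i) (mth i) v : ℝ) : ℂ)) ∈ piSchwartzBruhat K (Fin n))
    {B : ℂ → ℂ} (hB : Differentiable ℂ B)
    (hBsum : ∀ s : ℂ, 1 < s.re → s.re < 2 →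
      B s * (∑ i, c i * ((∏ v ∈ (hS'f i).toFinset,
          (satakePairPolynomial (α v) (β v)).eval ((v.residueCard : ℂ) ^ (-s))) *
        ∫ p in unitBox {v | v ∉ S' i} ×ˢ Set.univ, torusPairIntegrandC n K
          (fun g => whittakerCoeff ν₀ (unipotentTateDomain n K) (adeleAddChar K)
            (invQuot (AdelicGroupData.gl n K) (smoothedForm (η i) ((f i : P.1.toSubmodule) : (AdelicGroupData.gl n K).L2 μ')))
            (glDiagonal n (AdeleRing (𝓞 K) K) τ * g))
          (fun g => (star (whittakerCoeff ν₀ (unipotentTateDomain n K) (adeleAddChar K)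
            (invQuot (AdelicGroupData.gl n K) (smoothedForm (η i) ((f' i : P'.conj.1.toSubmodule) : (AdelicGroupData.gl n K).L2 μ')))))
            (glDiagonal n (AdeleRing (𝓞 K) K) τ * g))
          (thinTestFun n K (Φinf i) (Tth i) (mth i)) s p ∂(νA.prod νK))) = 1) :
    ∃ g : ℂ → ℂ, Differentiable ℂ g ∧ ∀ s : ℂ, 1 < s.re → g s = partialPairL S₀ α β s := by
  classical
  -- unramified Euler factors at `S'_i ∖ S₀` and their non-vanishing on `re s > 1`
  have hββ : (fun v => ((β v).map conj).map conj) = β := funext fun v => multiset_map_conj_map_conj _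
  have hmul : ∀ (i : Fin m) (s : ℂ), 1 < s.re → Multipliable fun v : {v : HeightOneSpectrum (𝓞 K) // v ∉ S' i} =>
      ((satakePairPolynomial (α v.1) (β v.1)).eval ((v.1.residueCard : ℂ) ^ (-s)))⁻¹ := fun i s hs =>
    JacquetShalika1981_multipliable_partialPairL_holds P P' (hα.mono (hS₀S' i)) (hβ.mono (hS₀S' i)) hs
  have hPne : ∀ (i : Fin m) (s : ℂ), 1 < s.re → ∀ v ∈ (hS'f i).toFinset,
      (satakePairPolynomial (α v) (β v)).eval ((v.residueCard : ℂ) ^ (-s)) ≠ 0 := fun i s hs v hv =>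
    eval_satakePairPolynomial_ne_zero_of_one_lt_re P P' hα hβ ((hS'f i).mem_toFinset.1 hv).2 hs
  by_cases hω : (∀ z : ideleGroup K, ∃ c : ℂ, ‖c‖ = 1 ∧
        (∀ f : P.1.toSubmodule,
          (AdelicGroupData.gl n K).rightRegular μ' (Matrix.GeneralLinearGroup.scalar (Fin n) z)
              (f : (AdelicGroupData.gl n K).L2 μ') = c • (f : (AdelicGroupData.gl n K).L2 μ')) ∧
        (∀ f' : P'.conj.1.toSubmodule,
          (AdelicGroupData.gl n K).rightRegular μ' (Matrix.GeneralLinearGroup.scalar (Fin n) z)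
              (f' : (AdelicGroupData.gl n K).L2 μ') = c • (f' : (AdelicGroupData.gl n K).L2 μ')))
  · /- a common central action: the untwisted global theorem, residues at `1` and `0` -/
    obtain ⟨C, hC, hT⟩ :=
      exists_entire_eq_mul_partialPairL_mul_setIntegral_pair_thin_translate (n := n) (K := K) hn μ' νI νA νK ν₀
    have hZ : ∀ (i : Fin m) (z : ideleGroup K), ∃ c : ℂ, ‖c‖ = 1 ∧
        (AdelicGroupData.gl n K).rightRegular μ' (Matrix.GeneralLinearGroup.scalar (Fin n) z)
            ((f i : P.1.toSubmodule) : (AdelicGroupData.gl n K).L2 μ') =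
          c • ((f i : P.1.toSubmodule) : (AdelicGroupData.gl n K).L2 μ') ∧
        (AdelicGroupData.gl n K).rightRegular μ' (Matrix.GeneralLinearGroup.scalar (Fin n) z)
            ((f' i : P'.conj.1.toSubmodule) : (AdelicGroupData.gl n K).L2 μ') =
          c • ((f' i : P'.conj.1.toSubmodule) : (AdelicGroupData.gl n K).L2 μ') := fun i z => by
      obtain ⟨d, hd, hP, hQ⟩ := hω z
      exact ⟨d, hd, hP (f i), hQ (f' i)⟩
    choose F hF hFI hFstrip hF1 using fun i : Fin m =>
      hT P P'.conj (f i) (f' i) (hZ i) hα hβ.conj (h𝔫₀ i) (hη i) (hηK i) (mth i) (hS₀S' i) (hTS' i) (hS' i) τ hτ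
        (hτψ i) (hx i) (hy i) (hΦc i) (hΦ0 i) (hΦS i)
    -- the residues of every `F_i` at `s = 1` and `s = 0`
    have hF1' : ∀ i, F i 1 = 0 := fun i => hF1 i h₁ hne
    have hF0' : ∀ i, F i 0 = 0 := fun i =>
      apply_zero_eq_zero_of_entire_eq_mul_rankinSelbergIntegral_of_ne_conj hn h₁ νI P P' hne (f i) (f' i) (hη i)
        (hΦS i) (hF i) (hFI i)
    -- `∑ c_i F_i = s (s - 1) · C · w_s(τ) · L^{S₀} · ∑ c_i A^τ_i` on the strip
    have hsum : ∀ s : ℂ, 1 < s.re → s.re < 2 →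
        ∑ i, c i * F i s = (s * (s - 1) * (C : ℂ) * torusWeightC n K s τ * partialPairL S₀ α β s) *
          ∑ i, c i * ((∏ v ∈ (hS'f i).toFinset,
                  (satakePairPolynomial (α v) (β v)).eval ((v.residueCard : ℂ) ^ (-s))) *
                ∫ p in unitBox {v | v ∉ S' i} ×ˢ Set.univ, torusPairIntegrandC n K
                  (fun g => whittakerCoeff ν₀ (unipotentTateDomain n K) (adeleAddChar K)
                    (invQuot (AdelicGroupData.gl n K) (smoothedForm (η i) ((f i : P.1.toSubmodule) : (AdelicGroupData.gl n K).L2 μ')))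
                    (glDiagonal n (AdeleRing (𝓞 K) K) τ * g))
                  (fun g => (star (whittakerCoeff ν₀ (unipotentTateDomain n K) (adeleAddChar K)
                    (invQuot (AdelicGroupData.gl n K) (smoothedForm (η i) ((f' i : P'.conj.1.toSubmodule) : (AdelicGroupData.gl n K).L2 μ')))))
                    (glDiagonal n (AdeleRing (𝓞 K) K) τ * g))
                  (thinTestFun n K (Φinf i) (Tth i) (mth i)) s p ∂(νA.prod νK)) := by
      intro s hs1 hs2
      rw [Finset.mul_sum]
      refine Finset.sum_congr rfl fun i _ => ?_
      have h := hFstrip i s hs1 hs2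
      beta_reduce at h
      rw [hββ] at h
      have hP0 : (∏ v ∈ (hS'f i).toFinset,
                  (satakePairPolynomial (α v) (β v)).eval ((v.residueCard : ℂ) ^ (-s))) ≠ 0 :=
        Finset.prod_ne_zero_iff.2 (hPne i s hs1)
      rw [h, partialPairL_eq_prod_mul_partialPairL (hS₀S' i) (hS'f i) α β (hmul i s hs1), Finset.prod_inv_distrib]
      field_simp
    -- the entire function `G = C⁻¹ B ∑ c_i F_i`
    set G : ℂ → ℂ := fun s => (C : ℂ)⁻¹ * ((torusWeightC n K s τ)⁻¹ * (B s * ∑ i, c i * F i s)) with hGdef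
    have hC0 : (C : ℂ) ≠ 0 := Complex.ofReal_ne_zero.2 hC.ne'
    have hsumF : Differentiable ℂ fun s => ∑ i, c i * F i s := by
      have h : Differentiable ℂ (∑ i, fun s => c i * F i s) := Differentiable.sum fun i _ => (hF i).const_mul (c i)
      convert h using 1
      funext s
      simp only [Finset.sum_apply]
    have htw : Differentiable ℂ fun s => (torusWeightC n K s τ)⁻¹ :=
      (differentiable_torusWeightC τ).inv fun s => torusWeightC_ne_zero s τ
    have hG : Differentiable ℂ G := by
      show Differentiable ℂ fun s => (C : ℂ)⁻¹ * ((torusWeightC n K s τ)⁻¹ * (B s * ∑ i, c i * F i s))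
      exact (htw.mul (hB.mul hsumF)).const_mul _
    have hGstrip : ∀ s : ℂ, 1 < s.re → s.re < 2 → G s = s * (s - 1) * partialPairL S₀ α β s := by
      intro s hs1 hs2
      have h1 := hBsum s hs1 hs2
      have htw0 := torusWeightC_ne_zero (n := n) (K := K) s τ
      show (C : ℂ)⁻¹ * ((torusWeightC n K s τ)⁻¹ * (B s * ∑ i, c i * F i s)) = _
      rw [hsum s hs1 hs2, mul_left_comm (B s), h1, mul_one]
      field_simp
    have hGL : ∀ s : ℂ, 1 < s.re → G s = s * (s - 1) * partialPairL S₀ α β s :=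
      eq_mul_partialPairL_of_eqOn_strip P P' hα hβ hG (differentiable_id.mul (differentiable_id.sub_const 1)) hGstrip
    have hG1 : G 1 = 0 := by
      show (C : ℂ)⁻¹ * ((torusWeightC n K 1 τ)⁻¹ * (B 1 * ∑ i, c i * F i 1)) = 0
      rw [Finset.sum_eq_zero fun i _ => by rw [hF1' i, mul_zero], mul_zero, mul_zero, mul_zero]
    have hG0 : G 0 = 0 := by
      show (C : ℂ)⁻¹ * ((torusWeightC n K 0 τ)⁻¹ * (B 0 * ∑ i, c i * F i 0)) = 0
      rw [Finset.sum_eq_zero fun i _ => by rw [hF0' i, mul_zero], mul_zero, mul_zero, mul_zero]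
    exact exists_entire_eq_of_entire_mul_of_apply_eq_zero hG hG0 hG1 hGL
  · /- no common central action: the twisted global theorem -/
    -- the central characters of `π` and `σ̄` differ
    obtain ⟨ω, hωu, hωA, hωact, hωS, -, -⟩ := P.exists_centralCharacter_smoothedForm
    obtain ⟨ω', hω'u, hω'A, hω'act, hω'S, -, -⟩ := P'.conj.exists_centralCharacter_smoothedForm
    have hωne : ω ≠ ω' := by
      intro hωeq
      refine hω fun z => ⟨((ω z : ℂˣ) : ℂ), hωu z, fun f => ?_, fun f' => ?_⟩
      · have h := congrArg Subtype.val (hωact z f)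
        rw [ContRepresentation.ClosedSubrep.coe_toContRep_apply, Submodule.coe_smul] at h
        exact h
      · have h := congrArg Subtype.val (hω'act z f')
        rw [ContRepresentation.ClosedSubrep.coe_toContRep_apply, Submodule.coe_smul, ← hωeq] at h
        exact h
    set χ : HeckeCharacter K := ω * ω'⁻¹ with hχ
    have hχ1 : χ ≠ 1 := by
      intro h
      apply hωne
      have h' := congrArg (· * ω') h
      simpa only [hχ, inv_mul_cancel_right, one_mul] using h'
    have hχ₀ : ∀ t : ℝ≥0ˣ, χ (posRealIdele K t) = 1 := fun t => by
      rw [hχ, HeckeCharacter.mul_apply, HeckeCharacter.inv_apply, hωA t, hω'A t, inv_one, mul_one]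
    -- the twisted global theorem
    obtain ⟨C, hC, hT⟩ :=
      exists_entire_eq_partialPairL_mul_setIntegral_pair_twisted_thin_translate (n := n) (K := K) hn μ' νI νA νK ν₀
    choose F hF hFI hFstrip using fun i : Fin m =>
      hT P P'.conj (f i) (f' i) hωu hω'u hχ hχ1 hχ₀ hα hβ.conj (h𝔫₀ i) (hη i) (hηK i)
        (fun z g => hωS (η i) (f i) z g) (fun z g => hω'S (η i) (f' i) z g) (mth i) (hS₀S' i) (hTS' i) (hS' i) τ hτ
        (hτψ i) (hx i) (hy i) (hΦc i) (hΦ0 i) (hΦS i)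
    -- `∑ c_i F_i = C · w_s(τ) · L^{S₀} · ∑ c_i A^τ_i` on the strip
    have hsum : ∀ s : ℂ, 1 < s.re → s.re < 2 →
        ∑ i, c i * F i s = ((C : ℂ) * torusWeightC n K s τ * partialPairL S₀ α β s) *
          ∑ i, c i * ((∏ v ∈ (hS'f i).toFinset,
                  (satakePairPolynomial (α v) (β v)).eval ((v.residueCard : ℂ) ^ (-s))) *
                ∫ p in unitBox {v | v ∉ S' i} ×ˢ Set.univ, torusPairIntegrandC n K
                  (fun g => whittakerCoeff ν₀ (unipotentTateDomain n K) (adeleAddChar K)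
                    (invQuot (AdelicGroupData.gl n K) (smoothedForm (η i) ((f i : P.1.toSubmodule) : (AdelicGroupData.gl n K).L2 μ')))
                    (glDiagonal n (AdeleRing (𝓞 K) K) τ * g))
                  (fun g => (star (whittakerCoeff ν₀ (unipotentTateDomain n K) (adeleAddChar K)
                    (invQuot (AdelicGroupData.gl n K) (smoothedForm (η i) ((f' i : P'.conj.1.toSubmodule) : (AdelicGroupData.gl n K).L2 μ')))))
                    (glDiagonal n (AdeleRing (𝓞 K) K) τ * g))
                  (thinTestFun n K (Φinf i) (Tth i) (mth i)) s p ∂(νA.prod νK)) := by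
      intro s hs1 hs2
      rw [Finset.mul_sum]
      refine Finset.sum_congr rfl fun i _ => ?_
      have h := hFstrip i s hs1 hs2
      beta_reduce at h
      rw [hββ] at h
      have hP0 : (∏ v ∈ (hS'f i).toFinset,
                  (satakePairPolynomial (α v) (β v)).eval ((v.residueCard : ℂ) ^ (-s))) ≠ 0 :=
        Finset.prod_ne_zero_iff.2 (hPne i s hs1)
      rw [h, partialPairL_eq_prod_mul_partialPairL (hS₀S' i) (hS'f i) α β (hmul i s hs1), Finset.prod_inv_distrib]
      field_simp
    -- the entire function `G = C⁻¹ B ∑ c_i F_i`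
    set G : ℂ → ℂ := fun s => (C : ℂ)⁻¹ * ((torusWeightC n K s τ)⁻¹ * (B s * ∑ i, c i * F i s)) with hGdef
    have hC0 : (C : ℂ) ≠ 0 := Complex.ofReal_ne_zero.2 hC.ne'
    have hsumF : Differentiable ℂ fun s => ∑ i, c i * F i s := by
      have h : Differentiable ℂ (∑ i, fun s => c i * F i s) := Differentiable.sum fun i _ => (hF i).const_mul (c i)
      convert h using 1
      funext s
      simp only [Finset.sum_apply]
    have htw : Differentiable ℂ fun s => (torusWeightC n K s τ)⁻¹ :=
      (differentiable_torusWeightC τ).inv fun s => torusWeightC_ne_zero s τ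
    have hG : Differentiable ℂ G := by
      show Differentiable ℂ fun s => (C : ℂ)⁻¹ * ((torusWeightC n K s τ)⁻¹ * (B s * ∑ i, c i * F i s))
      exact (htw.mul (hB.mul hsumF)).const_mul _
    have hGstrip : ∀ s : ℂ, 1 < s.re → s.re < 2 → G s = (fun _ : ℂ => (1 : ℂ)) s * partialPairL S₀ α β s := by
      intro s hs1 hs2
      have h1 := hBsum s hs1 hs2
      have htw0 := torusWeightC_ne_zero (n := n) (K := K) s τ
      show (C : ℂ)⁻¹ * ((torusWeightC n K s τ)⁻¹ * (B s * ∑ i, c i * F i s)) = 1 * partialPairL S₀ α β s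
      rw [hsum s hs1 hs2, mul_left_comm (B s), h1, mul_one]
      field_simp
    have hGL : ∀ s : ℂ, 1 < s.re → G s = (fun _ : ℂ => (1 : ℂ)) s * partialPairL S₀ α β s :=
      eq_mul_partialPairL_of_eqOn_strip P P' hα hβ hG (differentiable_const _) hGstrip
    exact ⟨G, hG, fun s hs => by rw [hGL s hs, one_mul]⟩

end LocalDataThinTranslate

end Literature.NumberTheory.Automorphic
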